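import Mathlib
import HarnessLib

/-!
# Route `RadicialJung`, crux `CleanModels` (stmt-15917), stub `stub_cleanLU3DefectNonDiscrete`, sub-line (C-div): LIFTING loose clean forms
# (2) and (3) along a surjection of local rings (glue G3 of the lead's memo `Cruxes/CleanModels/Lines/Sketch-memo-nondiscrete-classC.md`)

Line `Sketch` rev 24 of crux stmt-ResolutionOfSingularities-15917; lead `res-B-lead-1` g3.  OURS; nothing here proves resolution in
characteristic `p`.  For a composite valuation `v = v₁ ∘ v₂` whose rank-one coarsening `v₁ = ord_E` is divisorial, the clean-form problem descends
to the residue surface `E` (in-tree dim-2 clean models) and must be LIFTED back through `R ↠ R/(t_E) = 𝒪_{E,x}`.  Forms (2) («a unit, residually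
not a `p`-th power») and (3) («`≡ c^p` modulo `𝔪 ∖ 𝔪²`») lift VERBATIM along any surjection `f : R →+* S` of local rings, for arbitrary lifts —
this file; form (1) needs blow-ups of curves (memo G3′, not here).

* `mem_maximalIdeal_of_map_mem` — `f x ∈ 𝔪_S ⟹ x ∈ 𝔪_R` (any ring hom of local rings).
* `map_maximalIdeal_le_of_surjective` — `f(𝔪_R) ⊆ 𝔪_S` for `f` surjective.
* `not_mem_sq_of_map_not_mem_sq` — `f x ∉ 𝔪_S² ⟹ x ∉ 𝔪_R²` (`f` surjective).
* `isUnit_of_map_isUnit_of_surjective` — `f u` a unit ⟹ `u` a unit (`f` surjective).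
* `formThree_lift`, `formTwo_lift` — the two lifts; `map_lineRep` — `f` transports representatives `Σ c_j^p x^j` of the `K^p`-line.
-/

noncomputable section

set_option linter.dupNamespace false -- mandated namespace of this single-conjunct summit

open IsLocalRing

namespace Summit.ResolutionOfSingularities.ResolutionOfSingularities.Theorems.RadicialJung.CleanModels

variable {R S : Type} [CommRing R] [CommRing S] [IsLocalRing R] [IsLocalRing S] (f : R →+* S)

/-- **Non-units pull back**: along any ring hom of local rings, `f x ∈ 𝔪_S ⟹ x ∈ 𝔪_R` (units map to units). [folklore] -/
theorem mem_maximalIdeal_of_map_mem {x : R} (hx : f x ∈ maximalIdeal S) : x ∈ maximalIdeal R := by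
  rw [IsLocalRing.mem_maximalIdeal, mem_nonunits_iff]
  intro hu
  exact (IsLocalRing.mem_maximalIdeal _).mp hx (hu.map f)

/-- **The maximal ideal maps into the maximal ideal** along a SURJECTIVE ring hom of local rings: if `f(𝔪_R) = S` then `f y = 1` for some
`y ∈ 𝔪_R`, so `f (1 - y) = 0` with `1 - y` a unit — `S` would be trivial. [folklore] -/
theorem map_maximalIdeal_le_of_surjective (hf : Function.Surjective f) : (maximalIdeal R).map f ≤ maximalIdeal S := by
  apply IsLocalRing.le_maximalIdeal
  intro htop
  have h1 : (1 : S) ∈ (maximalIdeal R).map f := by rw [htop]; exact Submodule.mem_top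
  rw [Ideal.mem_map_iff_of_surjective f hf] at h1
  obtain ⟨y, hy, hy1⟩ := h1
  have hu : IsUnit (1 - y) := by
    by_contra hnu
    have hmem : (1 - y) ∈ maximalIdeal R := (IsLocalRing.mem_maximalIdeal _).mpr hnu
    have : (1 : R) ∈ maximalIdeal R := by
      have := (maximalIdeal R).add_mem hmem hy
      rwa [sub_add_cancel] at this
    exact (IsLocalRing.maximalIdeal.isMaximal R).ne_top ((Ideal.eq_top_iff_one _).mpr this)
  have h0 : f (1 - y) = 0 := by rw [map_sub, map_one, hy1, sub_self]
  have hu' : IsUnit (f (1 - y)) := hu.map f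
  rw [h0] at hu'
  exact not_isUnit_zero hu'

/-- **Order `≥ 2` pushes forward**, contrapositively: `f x ∉ 𝔪_S² ⟹ x ∉ 𝔪_R²` (`f` surjective). [folklore] -/
theorem not_mem_sq_of_map_not_mem_sq (hf : Function.Surjective f) {x : R} (hx : f x ∉ maximalIdeal S ^ 2) :
    x ∉ maximalIdeal R ^ 2 := by
  intro hx2
  apply hx
  have h1 : f x ∈ (maximalIdeal R ^ 2).map f := Ideal.mem_map_of_mem f hx2
  rw [Ideal.map_pow] at h1
  exact Ideal.pow_right_mono (map_maximalIdeal_le_of_surjective f hf) 2 h1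

/-- **Units pull back** along a surjective ring hom of local rings. [folklore] -/
theorem isUnit_of_map_isUnit_of_surjective (hf : Function.Surjective f) {u : R} (hu : IsUnit (f u)) : IsUnit u := by
  by_contra hnu
  have hmem : u ∈ maximalIdeal R := (IsLocalRing.mem_maximalIdeal _).mpr hnu
  have : f u ∈ maximalIdeal S := map_maximalIdeal_le_of_surjective f hf (Ideal.mem_map_of_mem f hmem)
  exact (IsLocalRing.mem_maximalIdeal _).mp this hu

/-- **Loose clean form (3) lifts**: if `f s - (f c)^p ∈ 𝔪_S ∖ 𝔪_S²` then `s - c^p ∈ 𝔪_R ∖ 𝔪_R²`, for ANY `s, c` upstairs (`f` surjective).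
[folklore] -/
theorem formThree_lift (hf : Function.Surjective f) (p : ℕ) (s c : R)
    (h1 : f s - f c ^ p ∈ maximalIdeal S) (h2 : f s - f c ^ p ∉ maximalIdeal S ^ 2) :
    s - c ^ p ∈ maximalIdeal R ∧ s - c ^ p ∉ maximalIdeal R ^ 2 := by
  have he : f (s - c ^ p) = f s - f c ^ p := by rw [map_sub, map_pow]
  rw [← he] at h1 h2
  exact ⟨mem_maximalIdeal_of_map_mem f h1, not_mem_sq_of_map_not_mem_sq f hf h2⟩

/-- **Loose clean form (2) lifts**: if `f u` is a unit that is residually not a `p`-th power (`f u - c'^p ∉ 𝔪_S` for all `c'`), then `u` is a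
unit with `u - c^p ∉ 𝔪_R` for all `c` (`f` surjective). [folklore] -/
theorem formTwo_lift (hf : Function.Surjective f) (p : ℕ) (u : R) (hu : IsUnit (f u))
    (hres : ∀ c' : S, f u - c' ^ p ∉ maximalIdeal S) :
    IsUnit u ∧ ∀ c : R, u - c ^ p ∉ maximalIdeal R := by
  refine ⟨isUnit_of_map_isUnit_of_surjective f hf hu, fun c hc => hres (f c) ?_⟩
  have he : f (u - c ^ p) = f u - f c ^ p := by rw [map_sub, map_pow]
  rw [← he]
  exact map_maximalIdeal_le_of_surjective f hf (Ideal.mem_map_of_mem f hc)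

omit [IsLocalRing R] [IsLocalRing S] in
/-- **Representatives of the `K^p`-line are transported by ring homs**: `f (Σ_j c_j^p x^j) = Σ_j (f c_j)^p (f x)^j`. [folklore] -/
theorem map_lineRep (p : ℕ) (c : Fin p → R) (x : R) :
    f (∑ j : Fin p, c j ^ p * x ^ (j : ℕ)) = ∑ j : Fin p, f (c j) ^ p * f x ^ (j : ℕ) := by
  rw [map_sum]
  refine Finset.sum_congr rfl fun j _ => ?_
  rw [map_mul, map_pow, map_pow]

end Summit.ResolutionOfSingularities.ResolutionOfSingularities.Theorems.RadicialJung.CleanModels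

end
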